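import Literature.Geometry.Lorentzian.KerrSchildWaveCauchyProblem
import Literature.Geometry.Lorentzian.KerrSurfaceGravity
import Literature.Geometry.Lorentzian.KerrHawkingField
import HarnessLib

/-!
# The adiabatic (drifting-parameter) Kerr–Schild background

(family `gr`; namespace `Literature.Geometry.Lorentzian`, sub-namespace `AdiabaticKerr` for the
unbundled coefficient field and the bundled structure `AdiabaticKerrSchildBackground`.)

The "adiabatic Kerr" background of the two-timescale / self-force literature is *a Kerr metric
whose mass and spin are treated as arbitrary, slowly varying functions of a time parameter*
(Miller–Pound 2021, §II.C, eq. (51): `g = ĝ_{αβ}(x; Z, M̂) + ĥ_{αβ}`, "we take it to be a Kerr metric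
with mass `M_BH` and spin `S_BH` treated as arbitrary functions of some time parameter … in the true
evolution `ĝ` is only slowly varying"; §II.B: `M_BH ∼ M + δM(εt)`, `dM_BH/dt ∼ ε²`). No printed
source fixes a chart. Here the time parameter is the ingoing Kerr–Schild time `t* = x 0` of
`KerrSchild.lean` and the metric is written in the generalised Kerr–Schild form of Kerr–Schild 1965,
§2 (`KerrSchildWaveCauchyProblem.lean`): for parameter paths `M a : ℝ → ℝ`,

  `g = η + φ ℓ ⊗ ℓ`, `φ(x) = 2H_{M(x⁰), a(x⁰)}(x)`, `ℓ♯(x) = ℓ♯_{a(x⁰)}(x)`,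

i.e. at each instant `t* = x⁰` the coefficients ARE those of the Kerr metric `g_{M(t*), a(t*)}` in
ingoing Kerr–Schild Cartesian coordinates (`Kerr.scalarH`, `Kerr.nullVector`). Its inverse has the
components `g^{μν} = η^{μν} − φ ℓ^μ ℓ^ν` (`KerrSchild.inverseMetric`, Kerr–Schild 1965, §2, valid
because `ℓ` is `η`-null) and its wave operator is the divergence-form operator
`KerrSchild.waveOperator` (`det g = −1`). The nearest printed metric of this kind is Vaidya's
radiating Schwarzschild metric, with the mass a function of a *null* time: Coudray–Nicolas 2021,
§2, eq. (1) print the outgoing form `(1 − 2M(u)/r) du² + 2 du dr − r² dω²` (signature `+−−−`); the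
ingoing form in our signature, `−(1 − 2M(v)/r) dv² + 2 dv dr + r² dω²`, expands with `v = t* + r` to
`η + (2M(t* + r)/r) ℓ ⊗ ℓ`, `ℓ = dv = dt* + dr = Kerr.nullCovector 0` — the present construction
with `a = 0` and `M ∘ (t* + r)` in place of `M ∘ t*`.

## Contents

* `AdiabaticKerr.profile M a`, `AdiabaticKerr.nullField a`, `AdiabaticKerr.inverseMetric M a`,
  `AdiabaticKerr.waveOperator M a` — the coefficient field and its wave operator; for `a = 0` they
  are, by `rfl`, the field written inline in the route item `AdiabaticSchwarzschildEnergyBound`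
  (`inverseMetric_spin_zero`, `waveOperator_spin_zero`), and for constant paths they are the Kerr
  ones (`inverseMetric_const`, via `Kerr.inverseMetric_eq_kerrSchild`);
* `AdiabaticKerr.region a ρ = {ρ(x⁰) < r_{a(x⁰)}(x)}`, the chart domain above an inner-radius path
  `ρ` (mirroring `Kerr.region`; `ρ < r₊` gives horizon-penetrating domains, and for `a = 0` it is
  `{ρ(x⁰) < ‖x⃗‖}`, `mem_region_spin_zero`), and the **instantaneous exterior**
  `AdiabaticKerr.exterior M a = region a (r₊ ∘ (M, a)) = {r₊(M(x⁰), a(x⁰)) < r_{a(x⁰)}(x)}` (the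
  instantaneous domain of outer communications), both open for continuous paths; the horizon data
  `horizonAngularVelocity M a t = Ω_H = a/(2Mr₊) = a/(r₊² + a²)`, `surfaceGravity M a t = κ`,
  `horizonGenerator M a x = T + Ω_H(x⁰) Φ` (`Kerr.horizonAngularVelocity`, `Kerr.surfaceGravity`,
  `Kerr.hawkingVector` of the instantaneous parameters);
* API: `ℓ♯` is `η`-null wherever `r > 0` and `ℓ(∂_{t*}) = 1` everywhere, `g^{00} = −1 − φ`,
  symmetry, `φ ≥ 0` for `M ≥ 0`; joint smoothness of `r`, `H`, `ℓ`, `ℓ♯` in the parameters and the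
  point (`Kerr.contDiffAt_radius_comp`, `…_scalarH_comp`, `…_nullCovectorFun_comp`,
  `…_nullVector_comp`), whence the components `g^{μν}` are `C^n` at every point with `r > 0` when
  the paths are `C^n` (`contDiffAt_inverseMetric`), in particular on the instantaneous exterior;
* the ADIABATICITY predicate `AdiabaticKerr.IsAdiabatic M a M₀ χ η₀` (smooth paths in the compact
  subextremal box `M₀ ≤ M ≤ 2M₀`, `|a| ≤ χM`, `χ < 1`, with `|Ṁ|, |ȧ| ≤ η₀` and
  `|M̈|, |ä| ≤ η₀/M₀`) and the bundled `AdiabaticKerrSchildBackground M₀ χ η₀`.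

## Design choices

* Unbundled functions of the paths first, so that specialisations are definitional; the bundle is
  a thin wrapper. Time dependence through `t*` (the route's typed item uses `t*`; Vaidya's null
  time would do as well).
* The coefficient field is defined on all of `E4` with the junk values of `Kerr.scalarH`,
  `Kerr.nullVector` on the instantaneous ring `{r = 0}`; statements use it on `{r > 0}` only.
* `IsAdiabatic` carries `0 < M₀` and `χ < 1`, so an adiabatic path is pointwise subextremal
  (`IsAdiabatic.isSubextremal`); `η₀ = 0` (constant parameters) is allowed. No monotonicity of `M`
  is imposed (for `a ≠ 0` the mass may decrease while the area grows).

## What is deliberately not here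

The drifting metric as a bundled `LorentzianMetric`/`Spacetime` (only the chart coefficient field
and its divergence-form wave operator, as in `KerrSchildWaveCauchyProblem.lean`); its curvature
(it is not Ricci-flat: `G[ĝ] = O(Ṁ, ȧ)`, the source term `2G_{αβ}[ĝ]` of Miller–Pound (53)); the
Teukolsky / spin-weighted operators; any energy or decay statement (those are route items).

## References

* J. Miller, A. Pound, *Two-timescale evolution of extreme-mass-ratio inspirals*, Phys. Rev. D 103
  (2021) 064048 = arXiv:2006.11263, §II.B–C, eq. (51) (key `MillerPound2021`).
* R. P. Kerr, A. Schild, 1965, §2 (key `KerrSchild1965`); M. Visser, arXiv:0706.0622, (32)–(35).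
* A. Coudray, J.-P. Nicolas, *Geometry of Vaidya spacetimes*, Gen. Rel. Grav. 53 (2021) =
  arXiv:2101.06544, §2 eq. (1) (key `CoudrayNicolas2021`).
* M. Dafermos, I. Rodnianski, arXiv:0811.0354, §5.1 (horizon-penetrating Kerr–Schild charts;
  key `arXiv08110354`); M. Dafermos, I. Rodnianski, Y. Shlapentokh-Rothman, arXiv:1402.7034,
  §2.2.2 (`Ω_H`, `K`); R. M. Wald, *General Relativity*, 1984, (12.5.4) (`κ`); B. O'Neill, *The
  geometry of Kerr black holes*, 1995, Ch. 2, §2.3 (`r₊`, the exterior).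
-/

noncomputable section

open Set Filter
open scoped ContDiff Topology

namespace Literature.Geometry.Lorentzian

/-! ### Joint smoothness of the Kerr–Schild components in the parameters and the point -/

namespace Kerr

variable {F : Type*} [NormedAddCommGroup F] [NormedSpace ℝ F] {fM fa : F → ℝ} {g : F → E4} {p : F}
  {n : WithTop ℕ∞}

/-- **The Kerr–Schild radius `r_a(x)` is jointly `C^n` in `(a, x)` wherever it is positive**
(composition form: `q ↦ r_{a(q)}(g(q))` is `C^n` at `p` if `a`, `g` are): both square roots in
Visser's formula (35) have positive arguments there. [cite: arXiv07060622, (35)] -/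
theorem contDiffAt_radius_comp (ha : ContDiffAt ℝ n fa p) (hg : ContDiffAt ℝ n g p)
    (h : 0 < radius (fa p) (g p)) : ContDiffAt ℝ n (fun q ↦ radius (fa q) (g q)) p := by
  have hρ : ContDiffAt ℝ n (fun q ↦ E4.spatialNorm (g q) ^ 2) p :=
    contDiff_spatialNorm_sq.contDiffAt.comp p hg
  have h3 : ContDiffAt ℝ n (fun q ↦ g q 3) p := (contDiff_coord 3).contDiffAt.comp p hg
  have hD : ContDiffAt ℝ n (fun q ↦ radiusDiscr (fa q) (g q)) p := by
    unfold radiusDiscr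
    exact ((hρ.sub (ha.pow 2)).pow 2).add ((contDiffAt_const.mul (ha.pow 2)).mul (h3.pow 2))
  have hq : ContDiffAt ℝ n
      (fun q ↦ ((E4.spatialNorm (g q) ^ 2 - fa q ^ 2) + √(radiusDiscr (fa q) (g q))) / 2) p :=
    ((hρ.sub (ha.pow 2)).add (hD.sqrt (radiusDiscr_pos h).ne')).div_const 2
  have hpos : ((E4.spatialNorm (g p) ^ 2 - fa p ^ 2) + √(radiusDiscr (fa p) (g p))) / 2 ≠ 0 := by
    have h1 := radius_sq (fa p) (g p)
    have h2 : 0 < radius (fa p) (g p) ^ 2 := by positivity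
    rw [h1] at h2
    exact h2.ne'
  exact hq.sqrt hpos

/-- **`H = M r³/(r⁴ + a²z²)` is jointly `C^n` in `(M, a, x)` wherever `r > 0`** (composition
form). Visser arXiv:0706.0622, (33). [cite: arXiv07060622, (33)] -/
theorem contDiffAt_scalarH_comp (hM : ContDiffAt ℝ n fM p) (ha : ContDiffAt ℝ n fa p)
    (hg : ContDiffAt ℝ n g p) (h : 0 < radius (fa p) (g p)) :
    ContDiffAt ℝ n (fun q ↦ scalarH (fM q) (fa q) (g q)) p := by
  have hr := contDiffAt_radius_comp ha hg h
  have h3 : ContDiffAt ℝ n (fun q ↦ g q 3) p := (contDiff_coord 3).contDiffAt.comp p hg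
  unfold scalarH
  refine (hM.mul (hr.pow 3)).div ((hr.pow 4).add ((ha.pow 2).mul (h3.pow 2))) ?_
  positivity

/-- The components `ℓ_μ` of the Kerr–Schild null covector are jointly `C^n` in `(a, x)` wherever
`r > 0` (composition form). Visser arXiv:0706.0622, (34). [cite: arXiv07060622, (34)] -/
theorem contDiffAt_nullCovectorFun_comp (ha : ContDiffAt ℝ n fa p) (hg : ContDiffAt ℝ n g p)
    (h : 0 < radius (fa p) (g p)) (μ : Fin 4) :
    ContDiffAt ℝ n (fun q ↦ nullCovectorFun (fa q) (g q) μ) p := by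
  have hr := contDiffAt_radius_comp ha hg h
  have h1 : ContDiffAt ℝ n (fun q ↦ g q 1) p := (contDiff_coord 1).contDiffAt.comp p hg
  have h2 : ContDiffAt ℝ n (fun q ↦ g q 2) p := (contDiff_coord 2).contDiffAt.comp p hg
  have h3 : ContDiffAt ℝ n (fun q ↦ g q 3) p := (contDiff_coord 3).contDiffAt.comp p hg
  have hra : radius (fa p) (g p) ^ 2 + fa p ^ 2 ≠ 0 := by positivity
  fin_cases μ
  · simp only [nullCovectorFun, Fin.zero_eta, Fin.isValue, Matrix.cons_val_zero]
    exact contDiffAt_const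
  · simp only [nullCovectorFun, Fin.mk_one, Fin.isValue, Matrix.cons_val_one, Matrix.cons_val_zero]
    exact ((hr.mul h1).add (ha.mul h2)).div ((hr.pow 2).add (ha.pow 2)) hra
  · simp only [nullCovectorFun, Fin.reduceFinMk, Fin.isValue, Matrix.cons_val]
    exact ((hr.mul h2).sub (ha.mul h1)).div ((hr.pow 2).add (ha.pow 2)) hra
  · simp only [nullCovectorFun, Fin.reduceFinMk, Fin.isValue, Matrix.cons_val]
    exact h3.div hr h.ne'

/-- `ℓ♯_a(x)` is jointly `C^n` in `(a, x)` wherever `r > 0` (componentwise; composition form).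
[cite: arXiv07060622, (34)] -/
theorem contDiffAt_nullVector_comp (ha : ContDiffAt ℝ n fa p) (hg : ContDiffAt ℝ n g p)
    (h : 0 < radius (fa p) (g p)) : ContDiffAt ℝ n (fun q ↦ nullVector (fa q) (g q)) p := by
  rw [contDiffAt_euclidean]
  intro μ
  by_cases hμ : μ = 0
  · subst hμ
    simp only [nullVector_eq, if_true]
    exact (contDiffAt_nullCovectorFun_comp ha hg h 0).neg
  · simp only [nullVector_eq, hμ, if_false]
    exact contDiffAt_nullCovectorFun_comp ha hg h μ

end Kerr

/-! ### The drifting-parameter Kerr–Schild coefficient field -/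

namespace AdiabaticKerr

variable (M a : ℝ → ℝ)

/-- The **profile** `φ(x) = 2H_{M(x⁰), a(x⁰)}(x) = 2M(t*) r³/(r⁴ + a(t*)² z²)` of the drifting
Kerr–Schild metric `g = η + φ ℓ ⊗ ℓ`: the Kerr–Schild scalar of the instantaneous parameters
(Kerr–Schild 1965, §2; the parameters as functions of time: Miller–Pound 2021, §II.C, eq. (51)).
[cite: MillerPound2021, §II.C eq. (51)] -/
def profile (x : E4) : ℝ := 2 * Kerr.scalarH (M (x 0)) (a (x 0)) x

/-- The **raised null vector field** `ℓ♯(x) = ℓ♯_{a(x⁰)}(x)` of the drifting Kerr–Schild metric: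
the Kerr–Schild null vector of the instantaneous spin parameter (Kerr–Schild 1965, §2;
Miller–Pound 2021, §II.C, eq. (51)). [cite: MillerPound2021, §II.C eq. (51)] -/
def nullField (x : E4) : E4 := Kerr.nullVector (a (x 0)) x

/-- The **inverse-metric components** `g^{μν} = η^{μν} − φ ℓ^μ ℓ^ν` of the drifting Kerr–Schild
metric `g = η + φ ℓ ⊗ ℓ`, `φ = AdiabaticKerr.profile`, `ℓ♯ = AdiabaticKerr.nullField` (the
generalised Kerr–Schild inverse of Kerr–Schild 1965, §2, `KerrSchild.inverseMetric`).
[cite: KerrSchild1965, §2] -/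
def inverseMetric : E4 → Fin 4 → Fin 4 → ℝ :=
  KerrSchild.inverseMetric (profile M a) (nullField a)

/-- The **wave operator** `□_g u = ∂_μ(g^{μν} ∂_ν u)` of the drifting Kerr–Schild metric (the
divergence-form operator `KerrSchild.waveOperator` of `AdiabaticKerr.inverseMetric`; `det g = −1`
for every generalised Kerr–Schild metric, Kerr–Schild 1965, §2). [cite: KerrSchild1965, §2] -/
def waveOperator (u : E4 → ℝ) (x : E4) : ℝ := KerrSchild.waveOperator (inverseMetric M a) u x

/-- The **chart domain above an inner-radius path** `ρ`: `{x | ρ(x⁰) < r_{a(x⁰)}(x)}` (for constant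
`a`, `ρ` and `0 ≤ ρ` this is `Kerr.region a ρ`; `ρ < r₊` gives horizon-penetrating domains, as in
Dafermos–Rodnianski arXiv:0811.0354, §5.1). Meaningful for `0 ≤ ρ` (no `max ρ 0` is inserted,
unlike `Kerr.region`). [cite: arXiv08110354, §5.1] -/
def region (ρ : ℝ → ℝ) : Set E4 := {x | ρ (x 0) < Kerr.radius (a (x 0)) x}

/-- The **instantaneous exterior** `{x | r₊(M(x⁰), a(x⁰)) < r_{a(x⁰)}(x)}`: the points outside the
event-horizon radius of the instantaneous parameters (for constant parameters and `0 ≤ r₊` this is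
`Kerr.exterior M a`, O'Neill 1995, Ch. 2, §2.3). Meaningful for `0 ≤ M(x⁰)` (then `r₊ ≥ 0`).
[cite: ONeill1995, Ch. 2 §2.3] -/
def exterior : Set E4 := region a fun t ↦ Kerr.rPlus (M t) (a t)

/-- The **instantaneous angular velocity of the horizon** `Ω_H(t) = a(t)/(2M(t)r₊(t))`
(`= a/(r₊² + a²)` for `|a| ≤ M`, `horizonAngularVelocity_eq_div`). DRSR arXiv:1402.7034, §2.2.2.
[cite: DafermosRodnianskiShlapentokhrothman2014, §2.2.2] -/
def horizonAngularVelocity (t : ℝ) : ℝ := Kerr.horizonAngularVelocity (M t) (a t)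

/-- The **instantaneous surface gravity** `κ(t) = √(M² − a²)/(r₊² + a²)` of the parameters at time
`t` (Wald 1984, (12.5.4); `Kerr.surfaceGravity`). [cite: Wald1984GR, §12.5 eq. (12.5.4)] -/
def surfaceGravity (t : ℝ) : ℝ := Kerr.surfaceGravity (M t) (a t)

/-- The **instantaneous horizon generator** `K(x) = T + Ω_H(x⁰) Φ` (the Hawking vector
`Kerr.hawkingVector` of the instantaneous parameters). DRSR arXiv:1402.7034, §2.2.2.
[cite: DafermosRodnianskiShlapentokhrothman2014, §2.2.2] -/
def horizonGenerator (x : E4) : E4 := Kerr.hawkingVector (M (x 0)) (a (x 0)) x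

variable {M a}

/-- Unfolding of the profile. [cite: MillerPound2021, §II.C eq. (51)] -/
theorem profile_apply (x : E4) : profile M a x = 2 * Kerr.scalarH (M (x 0)) (a (x 0)) x := rfl

/-- Unfolding of the null field. [cite: MillerPound2021, §II.C eq. (51)] -/
theorem nullField_apply (x : E4) : nullField a x = Kerr.nullVector (a (x 0)) x := rfl

/-- Unfolding of the inverse metric: `g^{μν} = η^{μν} − φ ℓ^μ ℓ^ν`. [cite: KerrSchild1965, §2] -/
theorem inverseMetric_apply (x : E4) (μ ν : Fin 4) :
    inverseMetric M a x μ ν = Kerr.etaComp μ ν - profile M a x * nullField a x μ * nullField a x ν :=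
  rfl

/-- Unfolding of the wave operator. [cite: KerrSchild1965, §2] -/
theorem waveOperator_apply (u : E4 → ℝ) (x : E4) :
    waveOperator M a u x = KerrSchild.waveOperator (inverseMetric M a) u x := rfl

/-- The horizon generator, unfolded: `K(x) = ∂₀ + Ω_H(M(x⁰), a(x⁰)) (x₁ ∂₂ − x₂ ∂₁)`.
[cite: DafermosRodnianskiShlapentokhrothman2014, §2.2.2] -/
theorem horizonGenerator_apply (x : E4) : horizonGenerator M a x =
    E4.basisVector 0 + Kerr.horizonAngularVelocity (M (x 0)) (a (x 0)) • Kerr.axialVector x := rfl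

/-- Membership in the domain above an inner-radius path. [cite: arXiv08110354, §5.1] -/
theorem mem_region {ρ : ℝ → ℝ} {x : E4} : x ∈ region a ρ ↔ ρ (x 0) < Kerr.radius (a (x 0)) x :=
  Iff.rfl

/-- Membership in the instantaneous exterior. [cite: ONeill1995, Ch. 2 §2.3] -/
theorem mem_exterior {x : E4} :
    x ∈ exterior M a ↔ Kerr.rPlus (M (x 0)) (a (x 0)) < Kerr.radius (a (x 0)) x := Iff.rfl

/-- The instantaneous exterior lies in the domain above any inner-radius path below `r₊`.
[cite: arXiv08110354, §5.1] -/
theorem exterior_subset_region {ρ : ℝ → ℝ} (h : ∀ t, ρ t ≤ Kerr.rPlus (M t) (a t)) :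
    exterior M a ⊆ region a ρ := fun x hx ↦ (h (x 0)).trans_lt hx

/-- For `a = 0` the domain above `ρ` is `{ρ(x⁰) < ‖x⃗‖}` (`Kerr.radius_zero_left`), the shape of the
domain `{μ(x⁰) < ‖x⃗‖}` of the route item `AdiabaticSchwarzschildEnergyBound`; Schwarzschild in
ingoing Eddington–Finkelstein form, Dafermos–Rodnianski arXiv:0811.0354, §5.1.
[cite: arXiv08110354, §5.1] -/
theorem mem_region_spin_zero {ρ : ℝ → ℝ} {x : E4} :
    x ∈ region (fun _ ↦ 0) ρ ↔ ρ (x 0) < E4.spatialNorm x := by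
  rw [mem_region, Kerr.radius_zero_left]

/-- **Schwarzschild reduction (`a = 0`).** The inverse metric of the drifting background with zero
spin is, definitionally, the coefficient field
`KerrSchild.inverseMetric (fun y ↦ 2H_{M(y⁰),0}(y)) ℓ♯₀` written inline in the route item
`AdiabaticSchwarzschildEnergyBound`: the Schwarzschild metric in ingoing Eddington–Finkelstein =
Kerr–Schild form (Dafermos–Rodnianski arXiv:0811.0354, §5.1) with the mass evolving in `t*`
(Miller–Pound 2021, §II.B, `M_BH ∼ M + δM(εt)`). [cite: MillerPound2021, §II.B] -/
theorem inverseMetric_spin_zero (M : ℝ → ℝ) :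
    inverseMetric M (fun _ ↦ 0) =
      KerrSchild.inverseMetric (fun y ↦ 2 * Kerr.scalarH (M (y 0)) 0 y) (Kerr.nullVector 0) := rfl

/-- **Schwarzschild reduction of the wave operator (`a = 0`)**, definitional.
[cite: MillerPound2021, §II.B] -/
theorem waveOperator_spin_zero (M : ℝ → ℝ) (u : E4 → ℝ) (x : E4) :
    waveOperator M (fun _ ↦ 0) u x = KerrSchild.waveOperator
      (KerrSchild.inverseMetric (fun y ↦ 2 * Kerr.scalarH (M (y 0)) 0 y) (Kerr.nullVector 0)) u x :=
  rfl

/-- **Static reduction.** For constant parameter paths the drifting inverse metric is the Kerr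
inverse metric `Kerr.inverseMetric M a` (`Kerr.inverseMetric_eq_kerrSchild`). Kerr–Schild 1965, §2.
[cite: KerrSchild1965, §2] -/
theorem inverseMetric_const (M₁ a₁ : ℝ) :
    inverseMetric (fun _ ↦ M₁) (fun _ ↦ a₁) = Kerr.inverseMetric M₁ a₁ := by
  funext x μ ν
  exact (Kerr.inverseMetric_eq_kerrSchild M₁ a₁ x μ ν).symm

/-- For constant paths the domain above `ρ ≥ 0` is the Kerr chart domain `Kerr.region a ρ`.
[cite: arXiv08110354, §5.1] -/
theorem region_const {a₁ ρ₁ : ℝ} (h : 0 ≤ ρ₁) :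
    region (fun _ ↦ a₁) (fun _ ↦ ρ₁) = (Kerr.region a₁ ρ₁ : Set E4) := by
  ext x
  rw [mem_region, SetLike.mem_coe, Kerr.mem_region, max_eq_left h]

/-- For constant paths the instantaneous exterior is the Kerr exterior `Kerr.exterior M a`
whenever `0 ≤ r₊` (e.g. `0 ≤ M`). O'Neill 1995, Ch. 2, §2.3. [cite: ONeill1995, Ch. 2 §2.3] -/
theorem exterior_const {M₁ a₁ : ℝ} (h : 0 ≤ Kerr.rPlus M₁ a₁) :
    exterior (fun _ ↦ M₁) (fun _ ↦ a₁) = (Kerr.exterior M₁ a₁ : Set E4) :=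
  region_const h

/-- **`ℓ(∂_{t*}) = η(ℓ♯, ∂_{t*}) = 1` everywhere** (the normalisation of
`KerrSchild.Background`). Visser arXiv:0706.0622, (34). [cite: arXiv07060622, (34)] -/
theorem bilin_nullField_basisVector_zero (x : E4) :
    Minkowski.bilin (nullField a x) (E4.basisVector 0) = 1 := by
  rw [nullField_apply, Kerr.bilin_nullVector, Kerr.nullCovector_basisVector_zero]

/-- **`ℓ♯` is `η`-null wherever the instantaneous radius is positive**: `η(ℓ♯, ℓ♯) = ℓ(ℓ♯) = 0`
(Kerr–Schild 1965, §2; `Kerr.nullCovector_nullVector`). [cite: KerrSchild1965, §2] -/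
theorem bilin_nullField_self {x : E4} (hx : 0 < Kerr.radius (a (x 0)) x) :
    Minkowski.bilin (nullField a x) (nullField a x) = 0 := by
  rw [nullField_apply, Kerr.bilin_nullVector, Kerr.nullCovector_nullVector hx]

/-- **`g^{00} = −1 − φ`**: the slices `{t* = c}` are uniformly spacelike, lapse `(1 + φ)^{-1/2}`
(`KerrSchild.inverseMetric_zero_zero`; Visser arXiv:0706.0622, §5). [cite: arXiv07060622, §5] -/
theorem inverseMetric_zero_zero (x : E4) : inverseMetric M a x 0 0 = -1 - profile M a x :=
  KerrSchild.inverseMetric_zero_zero (bilin_nullField_basisVector_zero x)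

/-- The inverse metric is symmetric. [cite: KerrSchild1965, §2] -/
theorem inverseMetric_symm (x : E4) (μ ν : Fin 4) :
    inverseMetric M a x μ ν = inverseMetric M a x ν μ :=
  KerrSchild.inverseMetric_symm _ _ x μ ν

/-- `φ ≥ 0` wherever the instantaneous mass is nonnegative (`H ≥ 0`, Visser arXiv:0706.0622,
(33)): the light cones of `g` lie inside those of `η`. [cite: arXiv07060622, (33)] -/
theorem profile_nonneg {x : E4} (hM : 0 ≤ M (x 0)) : 0 ≤ profile M a x :=
  mul_nonneg zero_le_two (Kerr.scalarH_nonneg hM _ x)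

/-- `Ω_H(t) = a/(r₊² + a²)` for `|a(t)| ≤ M(t)` (`r₊² + a² = 2Mr₊`, `Kerr.rPlus_sq_add_sq`).
DRSR arXiv:1402.7034, §2.2.2. [cite: DafermosRodnianskiShlapentokhrothman2014, §2.2.2] -/
theorem horizonAngularVelocity_eq_div {t : ℝ} (h : |a t| ≤ M t) :
    horizonAngularVelocity M a t = a t / (Kerr.rPlus (M t) (a t) ^ 2 + a t ^ 2) := by
  rw [horizonAngularVelocity, Kerr.horizonAngularVelocity, Kerr.rPlus_sq_add_sq h]

/-- Above a nonnegative inner-radius path the instantaneous radius is positive.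
[cite: arXiv08110354, §5.1] -/
theorem radius_pos_of_mem_region {ρ : ℝ → ℝ} {x : E4} (hx : x ∈ region a ρ) (hρ : 0 ≤ ρ (x 0)) :
    0 < Kerr.radius (a (x 0)) x := hρ.trans_lt hx

/-- In the instantaneous exterior the instantaneous radius is positive as soon as `0 ≤ M(x⁰)`
(`r > r₊ ≥ M ≥ 0`). O'Neill 1995, Ch. 2, §2.3. [cite: ONeill1995, Ch. 2 §2.3] -/
theorem radius_pos_of_mem_exterior {x : E4} (hx : x ∈ exterior M a) (hM : 0 ≤ M (x 0)) :
    0 < Kerr.radius (a (x 0)) x := by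
  refine radius_pos_of_mem_region hx ?_
  have := Real.sqrt_nonneg (M (x 0) ^ 2 - a (x 0) ^ 2)
  simp only [Kerr.rPlus]
  linarith

/-- The instantaneous radius `x ↦ r_{a(x⁰)}(x)` is continuous for a continuous spin path
(Visser arXiv:0706.0622, (35)). [cite: arXiv07060622, (35)] -/
theorem continuous_radius (ha : Continuous a) : Continuous fun x : E4 ↦ Kerr.radius (a (x 0)) x := by
  have h0 : Continuous fun x : E4 ↦ x 0 := (Kerr.contDiff_coord 0 (n := 0)).continuous
  have h3 : Continuous fun x : E4 ↦ x 3 := (Kerr.contDiff_coord 3 (n := 0)).continuous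
  have hρ : Continuous fun x : E4 ↦ E4.spatialNorm x ^ 2 :=
    (Kerr.contDiff_spatialNorm_sq (n := 0)).continuous
  have ha' : Continuous fun x : E4 ↦ a (x 0) := ha.comp h0
  unfold Kerr.radius
  exact (((hρ.sub (ha'.pow 2)).add (((hρ.sub (ha'.pow 2)).pow 2).add
    ((continuous_const.mul (ha'.pow 2)).mul (h3.pow 2))).sqrt).div_const 2).sqrt

/-- The domain above a continuous inner-radius path is open, for a continuous spin path.
[cite: arXiv08110354, §5.1] -/
theorem isOpen_region {ρ : ℝ → ℝ} (ha : Continuous a) (hρ : Continuous ρ) : IsOpen (region a ρ) :=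
  isOpen_lt (hρ.comp (Kerr.contDiff_coord 0 (n := 0)).continuous) (continuous_radius ha)

/-- **The instantaneous exterior is open** for continuous parameter paths.
[cite: ONeill1995, Ch. 2 §2.3] -/
theorem isOpen_exterior (hM : Continuous M) (ha : Continuous a) : IsOpen (exterior M a) := by
  refine isOpen_region ha ?_
  unfold Kerr.rPlus
  exact hM.add ((hM.pow 2).sub (ha.pow 2)).sqrt

section Smooth

variable {n : WithTop ℕ∞}

/-- The profile is `C^n` at every point with positive instantaneous radius when the paths are
`C^n` (Visser arXiv:0706.0622, (33), with the chain rule in `t*`). [cite: arXiv07060622, (33)] -/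
theorem contDiffAt_profile (hM : ContDiff ℝ n M) (ha : ContDiff ℝ n a) {x : E4}
    (hx : 0 < Kerr.radius (a (x 0)) x) : ContDiffAt ℝ n (profile M a) x := by
  have h0 : ContDiffAt ℝ n (fun y : E4 ↦ y 0) x := (Kerr.contDiff_coord 0).contDiffAt
  exact contDiffAt_const.mul (Kerr.contDiffAt_scalarH_comp (hM.contDiffAt.comp x h0)
    (ha.contDiffAt.comp x h0) contDiffAt_id hx)

/-- The null field is `C^n` at every point with positive instantaneous radius when the spin path
is `C^n` (Visser arXiv:0706.0622, (34)). [cite: arXiv07060622, (34)] -/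
theorem contDiffAt_nullField (ha : ContDiff ℝ n a) {x : E4} (hx : 0 < Kerr.radius (a (x 0)) x) :
    ContDiffAt ℝ n (nullField a) x := by
  have h0 : ContDiffAt ℝ n (fun y : E4 ↦ y 0) x := (Kerr.contDiff_coord 0).contDiffAt
  exact Kerr.contDiffAt_nullVector_comp (ha.contDiffAt.comp x h0) contDiffAt_id hx

/-- **The components `g^{μν}` of the drifting inverse metric are `C^n` at every point with
positive instantaneous radius** when the parameter paths are `C^n` (explicit formula
`η^{μν} − φ ℓ^μ ℓ^ν`; Kerr–Schild 1965, §2). [cite: KerrSchild1965, §2] -/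
theorem contDiffAt_inverseMetric (hM : ContDiff ℝ n M) (ha : ContDiff ℝ n a) {x : E4}
    (hx : 0 < Kerr.radius (a (x 0)) x) (μ ν : Fin 4) :
    ContDiffAt ℝ n (fun y ↦ inverseMetric M a y μ ν) x := by
  have hV : ∀ κ, ContDiffAt ℝ n (fun y ↦ nullField a y κ) x :=
    fun κ ↦ contDiffAt_euclidean.mp (contDiffAt_nullField ha hx) κ
  simp only [inverseMetric_apply]
  exact contDiffAt_const.sub (((contDiffAt_profile hM ha hx).mul (hV μ)).mul (hV ν))

/-- The components `g^{μν}` are `C^n` on the domain above a nonnegative inner-radius path when the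
parameter paths are `C^n` (horizon-penetrating charts included). [cite: KerrSchild1965, §2] -/
theorem contDiffOn_inverseMetric_region (hM : ContDiff ℝ n M) (ha : ContDiff ℝ n a) {ρ : ℝ → ℝ}
    (hρ : ∀ t, 0 ≤ ρ t) (μ ν : Fin 4) :
    ContDiffOn ℝ n (fun y ↦ inverseMetric M a y μ ν) (region a ρ) := fun _ hx ↦
  (contDiffAt_inverseMetric hM ha (radius_pos_of_mem_region hx (hρ _)) μ ν).contDiffWithinAt

/-- The components `g^{μν}` are `C^n` on the instantaneous exterior when the paths are `C^n` and the
mass path is nonnegative. [cite: KerrSchild1965, §2] -/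
theorem contDiffOn_inverseMetric_exterior (hM : ContDiff ℝ n M) (ha : ContDiff ℝ n a)
    (hM0 : ∀ t, 0 ≤ M t) (μ ν : Fin 4) :
    ContDiffOn ℝ n (fun y ↦ inverseMetric M a y μ ν) (exterior M a) := fun _ hx ↦
  (contDiffAt_inverseMetric hM ha (radius_pos_of_mem_exterior hx (hM0 _)) μ ν).contDiffWithinAt

end Smooth

/-! ### Adiabaticity -/

/-- **Adiabatic (slowly drifting) subextremal Kerr parameters.** Smooth paths `M a : ℝ → ℝ` of the
Kerr–Schild time `t*` taking values in the compact subextremal box `M₀ ≤ M ≤ 2M₀`, `|a| ≤ χ M`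
(`0 < M₀`, `χ < 1`), with slow variation `|Ṁ|, |ȧ| ≤ η₀` and `|M̈|, |ä| ≤ η₀/M₀` (Miller–Pound
2021, §II.B–C: the background parameters are functions of the slow time `εt`, `dM_BH/dt ∼ ε²`; the
box and the second-derivative scale are the route's normalisation). [cite: MillerPound2021, §II.B–C] -/
structure IsAdiabatic (M a : ℝ → ℝ) (M₀ χ η₀ : ℝ) : Prop where
  /-- The mass scale is positive. -/
  pos : 0 < M₀
  /-- The extremality margin is strict. -/
  margin_lt_one : χ < 1
  /-- The mass path is smooth. -/
  contDiff_mass : ContDiff ℝ ∞ M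
  /-- The spin path is smooth. -/
  contDiff_spin : ContDiff ℝ ∞ a
  /-- The mass stays above the scale `M₀`. -/
  le_mass : ∀ t, M₀ ≤ M t
  /-- The mass stays below `2M₀`. -/
  mass_le : ∀ t, M t ≤ 2 * M₀
  /-- Uniform subextremality `|a| ≤ χ M`. -/
  abs_spin_le : ∀ t, |a t| ≤ χ * M t
  /-- Slow mass drift `|Ṁ| ≤ η₀`. -/
  abs_deriv_mass_le : ∀ t, |deriv M t| ≤ η₀
  /-- Slow spin drift `|ȧ| ≤ η₀`. -/
  abs_deriv_spin_le : ∀ t, |deriv a t| ≤ η₀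
  /-- `|M̈| ≤ η₀/M₀`. -/
  abs_deriv_deriv_mass_le : ∀ t, |deriv (deriv M) t| ≤ η₀ / M₀
  /-- `|ä| ≤ η₀/M₀`. -/
  abs_deriv_deriv_spin_le : ∀ t, |deriv (deriv a) t| ≤ η₀ / M₀

namespace IsAdiabatic

variable {M₀ χ η₀ : ℝ}

/-- An adiabatic mass path is positive. [cite: MillerPound2021, §II.B–C] -/
theorem mass_pos (h : IsAdiabatic M a M₀ χ η₀) (t : ℝ) : 0 < M t := h.pos.trans_le (h.le_mass t)

/-- The slowness parameter of an adiabatic path is nonnegative. [cite: MillerPound2021, §II.B–C] -/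
theorem rate_nonneg (h : IsAdiabatic M a M₀ χ η₀) : 0 ≤ η₀ :=
  (abs_nonneg _).trans (h.abs_deriv_mass_le 0)

/-- **Adiabatic parameters are pointwise subextremal**: `|a(t)| ≤ χ M(t) < M(t)`.
[cite: MillerPound2021, §II.B–C] -/
theorem isSubextremal (h : IsAdiabatic M a M₀ χ η₀) (t : ℝ) : Kerr.IsSubextremal (M t) (a t) := by
  have hM := h.mass_pos t
  have : χ * M t < M t := by nlinarith [h.margin_lt_one]
  exact (h.abs_spin_le t).trans_lt this

/-- Along an adiabatic path the instantaneous surface gravity is positive (non-degenerate horizon;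
`Kerr.IsSubextremal.surfaceGravity_pos`). [cite: Wald1984GR, §12.5 eq. (12.5.4)] -/
theorem surfaceGravity_pos (h : IsAdiabatic M a M₀ χ η₀) (t : ℝ) : 0 < surfaceGravity M a t :=
  (h.isSubextremal t).surfaceGravity_pos

/-- The instantaneous exterior of an adiabatic background is open. [cite: ONeill1995, Ch. 2 §2.3] -/
theorem isOpen_exterior (h : IsAdiabatic M a M₀ χ η₀) : IsOpen (exterior M a) :=
  AdiabaticKerr.isOpen_exterior h.contDiff_mass.continuous h.contDiff_spin.continuous

/-- The inverse-metric components of an adiabatic background are smooth on its instantaneous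
exterior. [cite: KerrSchild1965, §2] -/
theorem contDiffOn_inverseMetric (h : IsAdiabatic M a M₀ χ η₀) (μ ν : Fin 4) :
    ContDiffOn ℝ ∞ (fun y ↦ inverseMetric M a y μ ν) (exterior M a) :=
  contDiffOn_inverseMetric_exterior h.contDiff_mass h.contDiff_spin (fun t ↦ (h.mass_pos t).le) μ ν

/-- Constant subextremal parameters are adiabatic with rate `η₀ = 0`, for the scale `M₀ = M` and any
margin `|a|/M ≤ χ < 1` (the static Kerr background). [cite: MillerPound2021, §II.B–C] -/
theorem const {M₁ a₁ χ : ℝ} (hM : 0 < M₁) (hχ : χ < 1) (ha : |a₁| ≤ χ * M₁) :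
    IsAdiabatic (fun _ ↦ M₁) (fun _ ↦ a₁) M₁ χ 0 where
  pos := hM
  margin_lt_one := hχ
  contDiff_mass := contDiff_const
  contDiff_spin := contDiff_const
  le_mass _ := le_rfl
  mass_le _ := by linarith
  abs_spin_le _ := ha
  abs_deriv_mass_le _ := by simp
  abs_deriv_spin_le _ := by simp
  abs_deriv_deriv_mass_le _ := by simp
  abs_deriv_deriv_spin_le _ := by simp

end IsAdiabatic

end AdiabaticKerr

/-! ### The bundled background -/

/-- An **adiabatic Kerr–Schild background** with mass scale `M₀`, extremality margin `χ` and drift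
rate `η₀`: parameter paths `t* ↦ (M(t*), a(t*))` satisfying `AdiabaticKerr.IsAdiabatic`, carrying the
drifting generalised Kerr–Schild coefficient field `g^{μν} = η^{μν} − 2H_{M(t*),a(t*)} ℓ^μ ℓ^ν` and
its wave operator (Miller–Pound 2021, §II.C, eq. (51), in the ingoing Kerr–Schild chart of
Kerr–Schild 1965, §2). [cite: MillerPound2021, §II.C eq. (51)] -/
structure AdiabaticKerrSchildBackground (M₀ χ η₀ : ℝ) where
  /-- The mass path `t* ↦ M(t*)`. -/
  mass : ℝ → ℝ
  /-- The spin path `t* ↦ a(t*)`. -/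
  spin : ℝ → ℝ
  /-- The paths are adiabatic. -/
  isAdiabatic : AdiabaticKerr.IsAdiabatic mass spin M₀ χ η₀

namespace AdiabaticKerrSchildBackground

variable {M₀ χ η₀ : ℝ} (B : AdiabaticKerrSchildBackground M₀ χ η₀)

/-- The profile `φ = 2H` of the background. [cite: MillerPound2021, §II.C eq. (51)] -/
abbrev profile : E4 → ℝ := AdiabaticKerr.profile B.mass B.spin

/-- The raised null vector field `ℓ♯` of the background. [cite: MillerPound2021, §II.C eq. (51)] -/
abbrev nullField : E4 → E4 := AdiabaticKerr.nullField B.spin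

/-- The inverse metric `g^{μν}` of the background. [cite: KerrSchild1965, §2] -/
abbrev inverseMetric : E4 → Fin 4 → Fin 4 → ℝ := AdiabaticKerr.inverseMetric B.mass B.spin

/-- The wave operator `□_g` of the background. [cite: KerrSchild1965, §2] -/
abbrev waveOperator (u : E4 → ℝ) (x : E4) : ℝ := AdiabaticKerr.waveOperator B.mass B.spin u x

/-- The chart domain of the background above an inner-radius path `ρ`. [cite: arXiv08110354, §5.1] -/
abbrev region (ρ : ℝ → ℝ) : Set E4 := AdiabaticKerr.region B.spin ρ

/-- The instantaneous exterior of the background. [cite: ONeill1995, Ch. 2 §2.3] -/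
abbrev exterior : Set E4 := AdiabaticKerr.exterior B.mass B.spin

/-- The static subextremal Kerr background as an adiabatic background with rate `0`.
[cite: MillerPound2021, §II.B–C] -/
def const {M₁ a₁ χ : ℝ} (hM : 0 < M₁) (hχ : χ < 1) (ha : |a₁| ≤ χ * M₁) :
    AdiabaticKerrSchildBackground M₁ χ 0 :=
  ⟨fun _ ↦ M₁, fun _ ↦ a₁, AdiabaticKerr.IsAdiabatic.const hM hχ ha⟩

/-- The inverse metric of the static background is the Kerr inverse metric.
[cite: KerrSchild1965, §2] -/
theorem inverseMetric_const {M₁ a₁ χ : ℝ} (hM : 0 < M₁) (hχ : χ < 1) (ha : |a₁| ≤ χ * M₁) :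
    (const hM hχ ha).inverseMetric = Kerr.inverseMetric M₁ a₁ :=
  AdiabaticKerr.inverseMetric_const M₁ a₁

end AdiabaticKerrSchildBackground

end Literature.Geometry.Lorentzian
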